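import Mathlib.Analysis.Asymptotics.Defs
import Mathlib.Analysis.SpecificLimits.Basic
import Mathlib.Algebra.Ring.GeomSum
import Mathlib.Data.Nat.Choose.Basic
import Mathlib.Data.Nat.Factorial.Basic
import Mathlib.RingTheory.Coprime.Lemmas
import HarnessLib

/-!
# Elementary asymptotics for `h⁰`-growth: binomial coefficients, sandwiches, and passing from
# multiples of `M` to all `n`

Görtz–Wedhorn II, Prop. 23.83 (`dim Γ(X, 𝓛^{⊗n}) = deg_𝓛(X)/d! · n^d + O(n^{d-1})` for `𝓛` ample on a
proper `k`-scheme of dimension `d`) is recorded in `Motives/AbelianVarietyDegree` as the named fact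
`CartierDivisor.asymptoticRiemannRoch_of_isAmple`, in the shape
`CartierDivisor.HasAsympDegree`: `(fun n ↦ h⁰(n • D) - δ n^d/d!) =O[atTop] (fun n ↦ n^{d-1})` (real
sequences indexed by `ℕ`, the exponent `d - 1` an integer power so that `d = 0` is covered). This
file collects the purely real-analytic lemmas through which a cohomology-free proof of that fact
(by comparison with `ℙ^d` along a finite morphism, a "Noether normalisation sandwich") passes:

* `abs_add_pow_sub_pow_le`, `isBigO_natCast_add_pow_sub_pow`: `(n + c)^d - n^d = O(n^{d-1})`, with an
  explicit constant uniform in `|c| ≤ E`;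
* `isBigO_choose_add_sub`, `isBigO_choose_sub_add_sub`: `C(n + s, d) = n^d/d! + O(n^{d-1})` and the
  same for `C(n - a + s, d)` (these are the values `h⁰(ℙ^d, 𝒪(n ± a)) = C(n ± a + d, d)`);
* `isBigO_of_le_of_le` (squeeze) and `isBigO_sub_of_choose_sandwich`: if
  `r C(n - a + s, d) ≤ u n ≤ r C(n + b, d)` eventually then `u n = r n^d/d! + O(n^{d-1})`;
* `isBigO_sub_of_isBigO_comp_mul`: if `u` is "eventually monotone under shifts" (`u m ≤ u (m + n)`
  for all `m` and all `n ≥ n₁` — for `u n = h⁰(n • D)` this is multiplication by a nonzero section of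
  `𝒪(n • D)`) and `u (M k) = δ k^d/d! + O(k^{d-1})` along the multiples of `M ≥ 1`, then
  `u n = (δ/M^d) n^d/d! + O(n^{d-1})` along all `n`;
* `exists_nat_eq_of_coprime`: a real `c ≥ 0` with `c a, c b ∈ ℕ` for coprime `a, b` is a natural
  number (Bézout) — used to see that the leading coefficient obtained from two coprime multiples
  `M, M'` of an ample divisor is an integer.

Everything here is elementary real analysis; nothing is specific to schemes (no scheme imports).

## References

* U. Görtz, T. Wedhorn, *Algebraic Geometry II: Cohomology of Schemes*, Springer Spektrum (2023),
  Prop. 23.83, p. 447 (the shape `δ n^d/d! + O(n^{d-1})` of the statements). [GortzWedhorn2023]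
-/

open Asymptotics Filter Finset

noncomputable section

namespace Literature.AlgebraicGeometry.Motives

/-! ### `(x + e)^d - x^d = O(x^{d-1})` with explicit constants -/

/-- For `x ≥ 1` and any real `e`:
`|(x + e)^{k+1} - x^{k+1}| ≤ |e| (k + 1) (1 + |e|)^k x^k` (from
`(x+e)^{k+1} - x^{k+1} = e · Σ_{i ≤ k} (x+e)^i x^{k-i}` and `|x + e| ≤ (1 + |e|) x`). [folklore] -/
theorem abs_add_pow_sub_pow_le (x e : ℝ) (hx : 1 ≤ x) (k : ℕ) :
    |(x + e) ^ (k + 1) - x ^ (k + 1)| ≤ |e| * (k + 1) * (1 + |e|) ^ k * x ^ k := by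
  have hx0 : 0 ≤ x := zero_le_one.trans hx
  have hgeom := geom_sum₂_mul (x + e) x (k + 1)
  rw [add_sub_cancel_left] at hgeom
  rw [← hgeom, abs_mul, mul_comm]
  have hbound : |∑ i ∈ range (k + 1), (x + e) ^ i * x ^ (k + 1 - 1 - i)| ≤
      (k + 1) * (1 + |e|) ^ k * x ^ k := by
    refine (abs_sum_le_sum_abs _ _).trans ?_
    have hterm : ∀ i ∈ range (k + 1), |(x + e) ^ i * x ^ (k + 1 - 1 - i)| ≤ (1 + |e|) ^ k * x ^ k := by
      intro i hi
      rw [Finset.mem_range] at hi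
      have hik : i ≤ k := Nat.lt_succ_iff.1 hi
      rw [abs_mul, abs_pow, abs_pow, abs_of_nonneg hx0, show k + 1 - 1 - i = k - i by omega]
      have h1 : |x + e| ≤ (1 + |e|) * x := by
        calc |x + e| ≤ |x| + |e| := abs_add_le _ _
          _ = x + |e| := by rw [abs_of_nonneg hx0]
          _ ≤ x + |e| * x := by nlinarith [abs_nonneg e]
          _ = (1 + |e|) * x := by ring
      have h2 : |x + e| ^ i ≤ ((1 + |e|) * x) ^ i :=
        pow_le_pow_left₀ (abs_nonneg _) h1 i
      have h3 : (1 + |e|) ^ i ≤ (1 + |e|) ^ k :=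
        pow_le_pow_right₀ (by linarith [abs_nonneg e]) hik
      calc |x + e| ^ i * x ^ (k - i) ≤ ((1 + |e|) * x) ^ i * x ^ (k - i) :=
            mul_le_mul_of_nonneg_right h2 (pow_nonneg hx0 _)
        _ = (1 + |e|) ^ i * x ^ k := by
            rw [mul_pow, mul_assoc, ← pow_add, Nat.add_sub_cancel' hik]
        _ ≤ (1 + |e|) ^ k * x ^ k := mul_le_mul_of_nonneg_right h3 (pow_nonneg hx0 _)
    calc ∑ i ∈ range (k + 1), |(x + e) ^ i * x ^ (k + 1 - 1 - i)|
        ≤ ∑ _i ∈ range (k + 1), (1 + |e|) ^ k * x ^ k := Finset.sum_le_sum hterm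
      _ = (k + 1) * (1 + |e|) ^ k * x ^ k := by
          rw [Finset.sum_const, Finset.card_range, nsmul_eq_mul]
          push_cast
          ring
  calc |e| * |∑ i ∈ range (k + 1), (x + e) ^ i * x ^ (k + 1 - 1 - i)|
      ≤ |e| * ((k + 1) * (1 + |e|) ^ k * x ^ k) := mul_le_mul_of_nonneg_left hbound (abs_nonneg e)
    _ = |e| * (k + 1) * (1 + |e|) ^ k * x ^ k := by ring

/-- Uniform version: for `x ≥ 1` and `|e| ≤ E`,
`|(x + e)^{k+1} - x^{k+1}| ≤ E (k + 1) (1 + E)^k x^k`. [folklore] -/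
theorem abs_add_pow_sub_pow_le_of_abs_le (x e E : ℝ) (hx : 1 ≤ x) (hE : |e| ≤ E) (k : ℕ) :
    |(x + e) ^ (k + 1) - x ^ (k + 1)| ≤ E * (k + 1) * (1 + E) ^ k * x ^ k := by
  refine (abs_add_pow_sub_pow_le x e hx k).trans ?_
  have hx0 : 0 ≤ x := zero_le_one.trans hx
  have h0 : 0 ≤ |e| := abs_nonneg e
  have h1 : (1 + |e|) ^ k ≤ (1 + E) ^ k := pow_le_pow_left₀ (by linarith) (by linarith) k
  have h2 : |e| * (k + 1) ≤ E * (k + 1) := mul_le_mul_of_nonneg_right hE (by positivity)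
  calc |e| * (k + 1) * (1 + |e|) ^ k * x ^ k ≤ E * (k + 1) * (1 + E) ^ k * x ^ k := by
        apply mul_le_mul_of_nonneg_right _ (pow_nonneg hx0 _)
        exact mul_le_mul h2 h1 (pow_nonneg (by linarith) _) (mul_nonneg (h0.trans hE) (by positivity))

/-- The target sequence `n ↦ n^{d-1}` (integer exponent) is `n ↦ n^k` when `d = k + 1`. [folklore] -/
theorem natCast_zpow_succ_sub_one (n k : ℕ) :
    (n : ℝ) ^ (((k + 1 : ℕ) : ℤ) - 1) = (n : ℝ) ^ k := by
  rw [show (((k + 1 : ℕ) : ℤ) - 1) = ((k : ℕ) : ℤ) by push_cast; ring, zpow_natCast]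

/-- For `d = 0` the target sequence `n ↦ n^{d-1}` is `n ↦ n⁻¹`. [folklore] -/
theorem natCast_zpow_zero_sub_one (n : ℕ) : (n : ℝ) ^ (((0 : ℕ) : ℤ) - 1) = (n : ℝ)⁻¹ := by
  simp

/-- **`(n + c)^d - n^d = O(n^{d-1})`** for a fixed real `c`, as `n → ∞` through `ℕ`. [folklore] -/
theorem isBigO_natCast_add_pow_sub_pow (c : ℝ) (d : ℕ) :
    (fun n : ℕ => ((n : ℝ) + c) ^ d - (n : ℝ) ^ d) =O[atTop] fun n : ℕ => (n : ℝ) ^ ((d : ℤ) - 1) := by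
  cases d with
  | zero => simpa using isBigO_zero (fun n : ℕ => (n : ℝ) ^ ((0 : ℤ) - 1)) atTop
  | succ k =>
    refine IsBigO.of_bound (|c| * (k + 1) * (1 + |c|) ^ k) ?_
    rw [Filter.eventually_atTop]
    refine ⟨1, fun n hn => ?_⟩
    rw [natCast_zpow_succ_sub_one, Real.norm_eq_abs, Real.norm_eq_abs,
      abs_of_nonneg (pow_nonneg (Nat.cast_nonneg (α := ℝ) n) k)]
    exact abs_add_pow_sub_pow_le (n : ℝ) c (by exact_mod_cast hn) k

/-- A sequence of reals `x n ≥ 1` (eventually) with bounded perturbations `|e n| ≤ E`: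
`(x n + e n)^d - (x n)^d = O((x n)^{d-1})`, here in the form needed below, with `x n = n / M` and the
comparison `(n/M)^{d-1} ≤ n^{d-1}` folded in: for `M ≥ 1`,
`(n/M + e n)^d - (n/M)^d = O(n^{d-1})`. [folklore] -/
theorem isBigO_div_add_pow_sub_pow {M : ℕ} (hM : 0 < M) {e : ℕ → ℝ} {E : ℝ}
    (he : ∀ᶠ n in atTop, |e n| ≤ E) (d : ℕ) :
    (fun n : ℕ => ((n : ℝ) / M + e n) ^ d - ((n : ℝ) / M) ^ d) =O[atTop]
      fun n : ℕ => (n : ℝ) ^ ((d : ℤ) - 1) := by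
  cases d with
  | zero => simpa using isBigO_zero (fun n : ℕ => (n : ℝ) ^ ((0 : ℤ) - 1)) atTop
  | succ k =>
    have hM1 : (1 : ℝ) ≤ M := by exact_mod_cast hM
    have hM0 : (0 : ℝ) < M := by exact_mod_cast hM
    refine IsBigO.of_bound (E * (k + 1) * (1 + E) ^ k) ?_
    filter_upwards [he, Filter.eventually_ge_atTop M] with n hn hnM
    have hx : (1 : ℝ) ≤ n / M := by
      rw [le_div_iff₀ hM0, one_mul]; exact_mod_cast hnM
    rw [natCast_zpow_succ_sub_one, Real.norm_eq_abs, Real.norm_eq_abs,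
      abs_of_nonneg (pow_nonneg (Nat.cast_nonneg (α := ℝ) n) k)]
    refine (abs_add_pow_sub_pow_le_of_abs_le _ _ E hx hn k).trans ?_
    have hE : 0 ≤ E := (abs_nonneg _).trans hn
    have hxk : ((n : ℝ) / M) ^ k ≤ (n : ℝ) ^ k := by
      apply pow_le_pow_left₀ (by positivity)
      rw [div_le_iff₀ hM0]
      exact le_mul_of_one_le_right (Nat.cast_nonneg n) hM1
    exact mul_le_mul_of_nonneg_left hxk (by positivity)

/-! ### Binomial coefficients: `C(n + s, d) = n^d/d! + O(n^{d-1})` -/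

/-- Squeeze principle for `O`: if `f ≤ g ≤ h` eventually and `f, h = O(t)` then `g = O(t)`.
[folklore] -/
theorem isBigO_of_le_of_le {f g h t : ℕ → ℝ} (hfg : ∀ᶠ n in atTop, f n ≤ g n)
    (hgh : ∀ᶠ n in atTop, g n ≤ h n) (hf : f =O[atTop] t) (hh : h =O[atTop] t) : g =O[atTop] t := by
  have h1 : g =O[atTop] fun n => ‖f n‖ + ‖h n‖ := by
    refine IsBigO.of_bound 1 ?_
    filter_upwards [hfg, hgh] with n h₁ h₂
    simp only [one_mul, Real.norm_eq_abs]
    rw [abs_of_nonneg (by positivity : 0 ≤ |f n| + |h n|)]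
    rw [abs_le]
    constructor
    · linarith [neg_abs_le (f n), abs_nonneg (h n)]
    · linarith [le_abs_self (h n), abs_nonneg (f n)]
  exact h1.trans (hf.norm_left.add hh.norm_left)

/-- `d! · C(m, d) - m'^d = O(m'^{d-1})`-type comparison: for naturals `m = n + s`,
`(n + s + 1 - d)^d ≤ d! C(n + s, d) ≤ (n + s)^d` (Mathlib `Nat.pow_sub_le_descFactorial`,
`Nat.descFactorial_le_pow`), whence **`C(n + s, d) = n^d/d! + O(n^{d-1})`**. [folklore] -/
theorem isBigO_choose_add_sub (s d : ℕ) :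
    (fun n : ℕ => (((n + s).choose d : ℕ) : ℝ) - (n : ℝ) ^ d / d.factorial) =O[atTop]
      fun n : ℕ => (n : ℝ) ^ ((d : ℤ) - 1) := by
  have hfact : (0 : ℝ) < d.factorial := by exact_mod_cast Nat.factorial_pos d
  -- it suffices to treat `d! C(n+s, d) - n^d`
  suffices h : (fun n : ℕ => ((d.factorial : ℕ) : ℝ) * (((n + s).choose d : ℕ) : ℝ) - (n : ℝ) ^ d)
      =O[atTop] fun n : ℕ => (n : ℝ) ^ ((d : ℤ) - 1) by
    refine (h.const_mul_left ((d.factorial : ℝ)⁻¹)).congr_left fun n => ?_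
    field_simp
  -- lower and upper bounds by `(n + c)^d`
  have hlow : ∀ᶠ n : ℕ in atTop, ((n : ℝ) + ((s : ℝ) + 1 - d)) ^ d ≤
      ((d.factorial : ℕ) : ℝ) * (((n + s).choose d : ℕ) : ℝ) := by
    filter_upwards [Filter.eventually_ge_atTop d] with n hn
    have h1 := Nat.pow_sub_le_descFactorial (n + s) d
    rw [Nat.descFactorial_eq_factorial_mul_choose] at h1
    have h2 : ((n + s + 1 - d : ℕ) : ℝ) = (n : ℝ) + ((s : ℝ) + 1 - d) := by
      rw [Nat.cast_sub (by omega)]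
      push_cast
      ring
    rw [← h2]
    exact_mod_cast h1
  have hup : ∀ᶠ n : ℕ in atTop, ((d.factorial : ℕ) : ℝ) * (((n + s).choose d : ℕ) : ℝ) ≤
      ((n : ℝ) + (s : ℝ)) ^ d := by
    filter_upwards with n
    have h1 := Nat.descFactorial_le_pow (n + s) d
    rw [Nat.descFactorial_eq_factorial_mul_choose] at h1
    exact_mod_cast h1
  refine isBigO_of_le_of_le (f := fun n : ℕ => ((n : ℝ) + ((s : ℝ) + 1 - d)) ^ d - (n : ℝ) ^ d)
    (h := fun n : ℕ => ((n : ℝ) + (s : ℝ)) ^ d - (n : ℝ) ^ d) ?_ ?_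
    (isBigO_natCast_add_pow_sub_pow _ d) (isBigO_natCast_add_pow_sub_pow _ d)
  · filter_upwards [hlow] with n hn
    linarith
  · filter_upwards [hup] with n hn
    linarith

/-- **`C(n - a + s, d) = n^d/d! + O(n^{d-1})`** (natural subtraction; the values for `n < a` are
irrelevant to the asymptotics). [folklore] -/
theorem isBigO_choose_sub_add_sub (a s d : ℕ) :
    (fun n : ℕ => (((n - a + s).choose d : ℕ) : ℝ) - (n : ℝ) ^ d / d.factorial) =O[atTop]
      fun n : ℕ => (n : ℝ) ^ ((d : ℤ) - 1) := by
  -- `C((n-a)+s, d) - (n-a)^d/d!` is `O((n-a)^{d-1})` hence `O(n^{d-1})`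
  have ht : Tendsto (fun n : ℕ => n - a) atTop atTop := tendsto_sub_atTop_nat a
  have h1 := (isBigO_choose_add_sub s d).comp_tendsto ht
  have h2 : (fun n : ℕ => (((n - a : ℕ) : ℕ) : ℝ) ^ ((d : ℤ) - 1)) =O[atTop]
      fun n : ℕ => (n : ℝ) ^ ((d : ℤ) - 1) := by
    cases d with
    | zero =>
      -- `(n - a)⁻¹ ≤ 2 n⁻¹` for `n ≥ 2a`
      refine IsBigO.of_bound 2 ?_
      filter_upwards [Filter.eventually_ge_atTop (2 * a + 2)] with n hn
      have hna : (0 : ℝ) < ((n - a : ℕ) : ℝ) := by exact_mod_cast (show 0 < n - a by omega)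
      have hn0 : (0 : ℝ) < n := by exact_mod_cast (show 0 < n by omega)
      rw [natCast_zpow_zero_sub_one, natCast_zpow_zero_sub_one, Real.norm_eq_abs, Real.norm_eq_abs,
        abs_of_pos (inv_pos.2 hna), abs_of_pos (inv_pos.2 hn0)]
      rw [inv_le_comm₀ hna (by positivity), mul_inv, inv_inv]
      have : ((n - a : ℕ) : ℝ) = (n : ℝ) - a := by rw [Nat.cast_sub (by omega)]
      rw [this]
      have ha : (2 : ℝ) * a + 2 ≤ n := by exact_mod_cast hn
      nlinarith
    | succ k =>
      refine IsBigO.of_bound 1 ?_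
      filter_upwards with n
      rw [natCast_zpow_succ_sub_one, natCast_zpow_succ_sub_one, one_mul, Real.norm_eq_abs,
        Real.norm_eq_abs, abs_of_nonneg (by positivity), abs_of_nonneg (by positivity)]
      exact pow_le_pow_left₀ (by positivity) (by exact_mod_cast Nat.sub_le n a) k
  have h3 : (fun n : ℕ => (((n - a + s).choose d : ℕ) : ℝ) - (((n - a : ℕ) : ℕ) : ℝ) ^ d / d.factorial)
      =O[atTop] fun n : ℕ => (n : ℝ) ^ ((d : ℤ) - 1) := h1.trans h2
  -- and `(n - a)^d - n^d = O(n^{d-1})`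
  have h4 : (fun n : ℕ => (((n - a : ℕ) : ℕ) : ℝ) ^ d - (n : ℝ) ^ d) =O[atTop]
      fun n : ℕ => (n : ℝ) ^ ((d : ℤ) - 1) := by
    refine (isBigO_natCast_add_pow_sub_pow (-(a : ℝ)) d).congr' ?_ EventuallyEq.rfl
    filter_upwards [Filter.eventually_ge_atTop a] with n hn
    rw [Nat.cast_sub hn]
    ring
  have h5 := h3.add (h4.const_mul_left ((d.factorial : ℝ)⁻¹))
  refine h5.congr_left fun n => ?_
  ring

/-! ### Sandwiches -/

/-- **From a binomial sandwich to the asymptotics**: if eventually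
`r · C(n - a + s, d) ≤ u n ≤ r · C(n + b, d)` then `u n = r n^d/d! + O(n^{d-1})`. (For `u n = h⁰(X, n f^*H)`
with `f : X → ℙ^d` finite of degree `r`: `h⁰(ℙ^d, 𝒪(m)) = C(m + d, d)`.) [folklore] -/
theorem isBigO_sub_of_choose_sandwich {u : ℕ → ℝ} {r : ℝ} {a s b d : ℕ}
    (hlow : ∀ᶠ n in atTop, r * (((n - a + s).choose d : ℕ) : ℝ) ≤ u n)
    (hup : ∀ᶠ n in atTop, u n ≤ r * (((n + b).choose d : ℕ) : ℝ)) :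
    (fun n : ℕ => u n - r * (n : ℝ) ^ d / d.factorial) =O[atTop] fun n : ℕ => (n : ℝ) ^ ((d : ℤ) - 1) := by
  refine isBigO_of_le_of_le
    (f := fun n : ℕ => r * (((n - a + s).choose d : ℕ) : ℝ) - r * (n : ℝ) ^ d / d.factorial)
    (h := fun n : ℕ => r * (((n + b).choose d : ℕ) : ℝ) - r * (n : ℝ) ^ d / d.factorial) ?_ ?_ ?_ ?_
  · filter_upwards [hlow] with n hn
    linarith
  · filter_upwards [hup] with n hn
    linarith
  · refine ((isBigO_choose_sub_add_sub a s d).const_mul_left r).congr_left fun n => ?_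
    ring
  · refine ((isBigO_choose_add_sub b d).const_mul_left r).congr_left fun n => ?_
    ring

/-! ### From the multiples of `M` to all `n` -/

/-- If `α n ≤ k n ≤ β n` eventually with `α > 0`, then `(k n)^{d-1} = O(n^{d-1})` for every
`d : ℕ` (for `d = 0` this uses the lower bound, for `d ≥ 1` the upper bound; no sign condition on
`β` is needed, the upper bound being vacuous otherwise). [folklore] -/
theorem isBigO_zpow_sub_one_of_le_of_le {k : ℕ → ℕ} {α β : ℝ} (hα : 0 < α)
    (hlow : ∀ᶠ n : ℕ in atTop, α * n ≤ k n) (hup : ∀ᶠ n : ℕ in atTop, (k n : ℝ) ≤ β * n) (d : ℕ) :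
    (fun n : ℕ => ((k n : ℕ) : ℝ) ^ ((d : ℤ) - 1)) =O[atTop] fun n : ℕ => (n : ℝ) ^ ((d : ℤ) - 1) := by
  cases d with
  | zero =>
    refine IsBigO.of_bound α⁻¹ ?_
    filter_upwards [hlow, Filter.eventually_ge_atTop 1] with n hn hn1
    have hn0 : (0 : ℝ) < n := by exact_mod_cast hn1
    have hk0 : (0 : ℝ) < k n := lt_of_lt_of_le (by positivity) hn
    rw [natCast_zpow_zero_sub_one, natCast_zpow_zero_sub_one, Real.norm_eq_abs, Real.norm_eq_abs,
      abs_of_pos (inv_pos.2 hk0), abs_of_pos (inv_pos.2 hn0), ← mul_inv]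
    exact inv_anti₀ (by positivity) hn
  | succ d =>
    refine IsBigO.of_bound (β ^ d) ?_
    filter_upwards [hup] with n hn
    rw [natCast_zpow_succ_sub_one, natCast_zpow_succ_sub_one, Real.norm_eq_abs,
      Real.norm_eq_abs, abs_of_nonneg (by positivity), abs_of_nonneg (by positivity), ← mul_pow]
    exact pow_le_pow_left₀ (by positivity) hn d

/-- The comparison step: if `k : ℕ → ℕ` satisfies `|k n - n/M| ≤ E` and `α n ≤ k n ≤ n` eventually
(`α > 0`, `M ≥ 1`), and `v (k n) - δ (k n)^d/d! = O((k n)^{d-1})`-type information is available in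
the form `w n := v (k n)` with `(w n - δ (k n)^d/d!) = O(n^{d-1})`, then
`w n - (δ/M^d) n^d/d! = O(n^{d-1})`. [folklore] -/
theorem isBigO_sub_div_pow_of_comp {w : ℕ → ℝ} {k : ℕ → ℕ} {M : ℕ} (hM : 0 < M) {δ E : ℝ} {d : ℕ}
    (hk : ∀ᶠ n : ℕ in atTop, |((k n : ℕ) : ℝ) - (n : ℝ) / M| ≤ E)
    (hw : (fun n : ℕ => w n - δ * ((k n : ℕ) : ℝ) ^ d / d.factorial) =O[atTop]
      fun n : ℕ => (n : ℝ) ^ ((d : ℤ) - 1)) :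
    (fun n : ℕ => w n - δ / (M : ℝ) ^ d * (n : ℝ) ^ d / d.factorial) =O[atTop]
      fun n : ℕ => (n : ℝ) ^ ((d : ℤ) - 1) := by
  -- `(k n)^d - (n/M)^d = O(n^{d-1})`
  have h1 : (fun n : ℕ => ((n : ℝ) / M + (((k n : ℕ) : ℝ) - (n : ℝ) / M)) ^ d - ((n : ℝ) / M) ^ d)
      =O[atTop] fun n : ℕ => (n : ℝ) ^ ((d : ℤ) - 1) :=
    isBigO_div_add_pow_sub_pow hM hk d
  have h2 := hw.add (h1.const_mul_left (δ / d.factorial))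
  refine h2.congr_left fun n => ?_
  have hM0 : (M : ℝ) ≠ 0 := by exact_mod_cast hM.ne'
  rw [show ((n : ℝ) / M + (((k n : ℕ) : ℝ) - (n : ℝ) / M)) = ((k n : ℕ) : ℝ) by ring, div_pow]
  field_simp
  ring

/-- **From multiples of `M` to all `n`.** Let `u : ℕ → ℝ` satisfy `u m ≤ u (m + n)` for all `m` and
all `n ≥ n₁` (for `u n = h⁰(n • D)`: multiplication by a nonzero section of `𝒪(n • D)`, which exists
for `n ≥ n₁` when `D` is ample), and suppose that along the multiples of `M ≥ 1`,
`u (M k) = δ k^d/d! + O(k^{d-1})`. Then `u n = (δ/M^d) n^d/d! + O(n^{d-1})`.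
Proof: `u (M k⁻) ≤ u n ≤ u (M k⁺)` with `k⁻ = (n - n₁)/M`, `k⁺ = (n + n₁)/M + 1`, both `= n/M + O(1)`.
[folklore] -/
theorem isBigO_sub_of_isBigO_comp_mul {u : ℕ → ℝ} {M n₁ d : ℕ} {δ : ℝ} (hM : 0 < M)
    (hmono : ∀ n, n₁ ≤ n → ∀ m, u m ≤ u (m + n))
    (h : (fun k : ℕ => u (M * k) - δ * (k : ℝ) ^ d / d.factorial) =O[atTop]
      fun k : ℕ => (k : ℝ) ^ ((d : ℤ) - 1)) :
    (fun n : ℕ => u n - δ / (M : ℝ) ^ d * (n : ℝ) ^ d / d.factorial) =O[atTop]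
      fun n : ℕ => (n : ℝ) ^ ((d : ℤ) - 1) := by
  have hM0 : (0 : ℝ) < M := by exact_mod_cast hM
  -- the two comparison sequences
  set kp : ℕ → ℕ := fun n => (n + n₁) / M + 1 with hkp
  set km : ℕ → ℕ := fun n => (n - n₁) / M with hkm
  have hkp1 : ∀ n, n + n₁ < M * kp n := fun n => by
    simp only [hkp]
    rw [Nat.mul_add, mul_one]
    have := Nat.lt_div_mul_add (a := n + n₁) hM
    linarith [Nat.mul_comm ((n + n₁) / M) M]
  have hkp2 : ∀ n, M * kp n ≤ n + n₁ + M := fun n => by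
    simp only [hkp]
    rw [Nat.mul_add, mul_one]
    have := Nat.div_mul_le_self (n + n₁) M
    linarith [Nat.mul_comm ((n + n₁) / M) M]
  have hkm1 : ∀ n, M * km n ≤ n - n₁ := fun n => by
    simp only [hkm]
    rw [Nat.mul_comm]
    exact Nat.div_mul_le_self _ _
  have hkm2 : ∀ n, n - n₁ < M * km n + M := fun n => by
    simp only [hkm]
    rw [Nat.mul_comm]
    exact Nat.lt_div_mul_add hM
  -- `u (M km) ≤ u n ≤ u (M kp)` for `n ≥ n₁`
  have hupper : ∀ᶠ n in atTop, u n ≤ u (M * kp n) := by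
    filter_upwards with n
    have e : M * kp n = n + (M * kp n - n) := by have := hkp1 n; omega
    rw [e]
    exact hmono _ (by have := hkp1 n; omega) n
  have hlower : ∀ᶠ n in atTop, u (M * km n) ≤ u n := by
    filter_upwards [Filter.eventually_ge_atTop n₁] with n hn
    have e : n = M * km n + (n - M * km n) := by have := hkm1 n; omega
    conv_rhs => rw [e]
    exact hmono _ (by have := hkm1 n; have := hkm2 n; omega) _
  -- both comparison sequences tend to infinity and are `n/M + O(1)`, between `n/(2M)` and `n`
  have htp : Tendsto kp atTop atTop := by
    rw [tendsto_atTop]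
    intro b
    filter_upwards [Filter.eventually_ge_atTop (M * b)] with n hn
    have h1 := hkp1 n
    by_contra hlt
    rw [not_le] at hlt
    have : M * kp n < M * b := Nat.mul_lt_mul_of_pos_left hlt hM
    omega
  have htm : Tendsto km atTop atTop := by
    rw [tendsto_atTop]
    intro b
    filter_upwards [Filter.eventually_ge_atTop (M * b + M + n₁)] with n hn
    have h2 := hkm2 n
    by_contra hlt
    rw [not_le] at hlt
    have h' : M * km n + M ≤ M * b := by
      have h3 : km n + 1 ≤ b := hlt
      have := Nat.mul_le_mul_left M h3
      rw [Nat.mul_add, mul_one] at this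
      exact this
    omega
  -- `|k± - n/M| ≤ (n₁ + M)/M`
  have habs : ∀ (q : ℕ) (n : ℕ), |(q : ℝ) * M - n| ≤ n₁ + M → |(q : ℝ) - (n : ℝ) / M| ≤ ((n₁ : ℝ) + M) / M :=
    fun q n hq => by
      rw [show (q : ℝ) - (n : ℝ) / M = ((q : ℝ) * M - n) / M by field_simp, abs_div, abs_of_pos hM0]
      exact div_le_div_of_nonneg_right hq hM0.le
  have hEp : ∀ᶠ n : ℕ in atTop, |((kp n : ℕ) : ℝ) - (n : ℝ) / M| ≤ ((n₁ : ℝ) + M) / M := by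
    filter_upwards with n
    have h1 : ((n : ℝ) + n₁) < M * (kp n : ℝ) := by exact_mod_cast hkp1 n
    have h2 : (M : ℝ) * (kp n : ℝ) ≤ n + n₁ + M := by exact_mod_cast hkp2 n
    refine habs _ _ (abs_le.2 ⟨?_, ?_⟩)
    · nlinarith [Nat.cast_nonneg (α := ℝ) n₁]
    · nlinarith
  have hEm : ∀ᶠ n : ℕ in atTop, |((km n : ℕ) : ℝ) - (n : ℝ) / M| ≤ ((n₁ : ℝ) + M) / M := by
    filter_upwards [Filter.eventually_ge_atTop n₁] with n hn
    have h1 : (M : ℝ) * (km n : ℝ) ≤ ((n - n₁ : ℕ) : ℝ) := by exact_mod_cast hkm1 n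
    have h2 : ((n - n₁ : ℕ) : ℝ) < M * (km n : ℝ) + M := by exact_mod_cast hkm2 n
    rw [Nat.cast_sub hn] at h1 h2
    refine habs _ _ (abs_le.2 ⟨?_, ?_⟩)
    · nlinarith [Nat.cast_nonneg (α := ℝ) n₁]
    · nlinarith [Nat.cast_nonneg (α := ℝ) n₁]
  have hcmp_p : (fun n : ℕ => ((kp n : ℕ) : ℝ) ^ ((d : ℤ) - 1)) =O[atTop]
      fun n : ℕ => (n : ℝ) ^ ((d : ℤ) - 1) := by
    refine isBigO_zpow_sub_one_of_le_of_le (α := 1 / M) (β := 3) (by positivity) ?_ ?_ d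
    · filter_upwards with n
      have h1 : ((n : ℝ) + n₁) < M * (kp n : ℝ) := by exact_mod_cast hkp1 n
      rw [one_div, inv_mul_le_iff₀ hM0]
      nlinarith [Nat.cast_nonneg (α := ℝ) n₁]
    · filter_upwards [Filter.eventually_ge_atTop (n₁ + M)] with n hn
      have h2 : (M : ℝ) * (kp n : ℝ) ≤ n + n₁ + M := by exact_mod_cast hkp2 n
      have hn' : ((n₁ : ℝ) + M) ≤ n := by exact_mod_cast hn
      have hM1 : (1 : ℝ) ≤ M := by exact_mod_cast hM
      have hk0 : (0 : ℝ) ≤ kp n := Nat.cast_nonneg _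
      nlinarith
  have hcmp_m : (fun n : ℕ => ((km n : ℕ) : ℝ) ^ ((d : ℤ) - 1)) =O[atTop]
      fun n : ℕ => (n : ℝ) ^ ((d : ℤ) - 1) := by
    refine isBigO_zpow_sub_one_of_le_of_le (α := 1 / (2 * M)) (β := 1) (by positivity) ?_ ?_ d
    · filter_upwards [Filter.eventually_ge_atTop (2 * (n₁ + M))] with n hn
      have h2 : ((n - n₁ : ℕ) : ℝ) < M * (km n : ℝ) + M := by exact_mod_cast hkm2 n
      rw [Nat.cast_sub (by omega)] at h2
      have hn' : (2 : ℝ) * (n₁ + M) ≤ n := by exact_mod_cast hn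
      rw [one_div, inv_mul_le_iff₀ (by positivity)]
      nlinarith
    · filter_upwards with n
      have h1 := hkm1 n
      have : km n ≤ n := by
        calc km n ≤ M * km n := Nat.le_mul_of_pos_left _ hM
          _ ≤ n - n₁ := h1
          _ ≤ n := Nat.sub_le _ _
      rw [one_mul]
      exact_mod_cast this
  -- transport the asymptotics along `kp`, `km`
  have hwp : (fun n : ℕ => u (M * kp n) - δ * ((kp n : ℕ) : ℝ) ^ d / d.factorial) =O[atTop]
      fun n : ℕ => (n : ℝ) ^ ((d : ℤ) - 1) := (h.comp_tendsto htp).trans hcmp_p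
  have hwm : (fun n : ℕ => u (M * km n) - δ * ((km n : ℕ) : ℝ) ^ d / d.factorial) =O[atTop]
      fun n : ℕ => (n : ℝ) ^ ((d : ℤ) - 1) := (h.comp_tendsto htm).trans hcmp_m
  have hp := isBigO_sub_div_pow_of_comp (w := fun n => u (M * kp n)) hM hEp hwp
  have hm := isBigO_sub_div_pow_of_comp (w := fun n => u (M * km n)) hM hEm hwm
  refine isBigO_of_le_of_le (f := fun n => u (M * km n) - δ / (M : ℝ) ^ d * (n : ℝ) ^ d / d.factorial)
    (h := fun n => u (M * kp n) - δ / (M : ℝ) ^ d * (n : ℝ) ^ d / d.factorial) ?_ ?_ hm hp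
  · filter_upwards [hlower] with n hn
    linarith
  · filter_upwards [hupper] with n hn
    linarith

/-! ### Integrality of the leading coefficient from two coprime multiples -/

/-- **Bézout**: a real number `c` such that `c · a` and `c · b` are natural numbers for two coprime
naturals `a, b` is itself a natural number (`c = c (x a + y b) = x (c a) + y (c b) ∈ ℤ`, and
`c ≥ 0` as soon as `a ≠ 0` or directly from the hypotheses when `a = b = 1`). [folklore] -/
theorem exists_nat_eq_of_coprime {c : ℝ} {a b : ℕ} (hab : Nat.Coprime a b) (hc : 0 ≤ c)
    (ha : ∃ m : ℕ, c * a = m) (hb : ∃ m : ℕ, c * b = m) : ∃ m : ℕ, c = m := by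
  obtain ⟨p, hp⟩ := ha
  obtain ⟨q, hq⟩ := hb
  obtain ⟨x, y, hxy⟩ := Nat.isCoprime_iff_coprime.2 hab
  have hz : c = ((x * p + y * q : ℤ) : ℝ) := by
    have e : (x : ℝ) * a + y * b = 1 := by exact_mod_cast hxy
    calc c = c * ((x : ℝ) * a + y * b) := by rw [e, mul_one]
      _ = x * (c * a) + y * (c * b) := by ring
      _ = ((x * p + y * q : ℤ) : ℝ) := by rw [hp, hq]; push_cast; ring
  have hnn : (0 : ℤ) ≤ x * p + y * q := by
    have : (0 : ℝ) ≤ ((x * p + y * q : ℤ) : ℝ) := hz ▸ hc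
    exact_mod_cast this
  refine ⟨(x * p + y * q).toNat, ?_⟩
  rw [hz]
  have : (((x * p + y * q).toNat : ℤ) : ℝ) = ((x * p + y * q : ℤ) : ℝ) := by
    rw [Int.toNat_of_nonneg hnn]
  rw [← this]
  norm_cast

end Literature.AlgebraicGeometry.Motives

end
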